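import Literature.Analysis.FluidPDE.ExtremeGrowthVorticityControl
import Literature.Analysis.FluidPDE.TorusClassicalH1Balance
import Literature.Analysis.FunctionSpaces.TorusSpaceTimeComposition
import HarnessLib

/-!
# The vorticity-tensor transport identity along classical Navier–Stokes solutions on `T^d`

Analysis/FluidPDE file (two pointwise definitions + theorems; no named facts). For a classical
solution `(u, p)` of the forced incompressible Navier–Stokes system on `T^d × [a, b]`
(`Torus.IsClassicalNSSolutionOn (Icc a b) ν f u p`), the antisymmetric part of the velocity
gradient — the **vorticity tensor** `Wᵢⱼ = ∂ᵢuⱼ − ∂ⱼuᵢ` (in `d = 3` the entries `W₁₂, W₂₀, W₀₁` are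
the components of `ω = ∇ × u`, and `|ω|² = ½ ∑ᵢⱼ Wᵢⱼ²` is the tree's orientation-free
`torusVorticitySqAt`; `W = −2Ω`, `Ω` the rotation matrix of Majda–Bertozzi 2002 (1.19)) — obeys,
pointwise on `[a, b] × T^d`,

`∂ₜWᵢⱼ + (u·∇)Wᵢⱼ = ν ΔWᵢⱼ − ((∇u ∇u)ᵢⱼ − (∇u ∇u)ⱼᵢ) + (∂ᵢfⱼ − ∂ⱼfᵢ)`,  `(∇u)ᵢₖ = ∂ᵢuₖ`,

the antisymmetric part of the gradient of the momentum equation (the pressure Hessian is symmetric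
and drops out): Majda–Bertozzi 2002, §1.4 (1.29)–(1.31), `DΩ/Dt + Ω𝒟 + 𝒟Ω = νΔΩ`, whose `d = 3`
reading is the vorticity equation (1.32) `Dω/Dt = 𝒟ω + νΔω`. The source of
`½∂ₜ|ω|²` is the **stretching density** `σ := −∑ᵢⱼ Wᵢⱼ (∇u∇u)ᵢⱼ = tr(S W²)`; on `T³` it is
`ωᵀ𝒟ω − (div u)|ω|²`, i.e. `ω·𝒟ω` for divergence-free fields ((1.32) paired with `ω`;
Doering–Gibbon 1995, §6.5), proved here as a polynomial identity. Sequel files: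
`TorusVorticitySqTransport` (`∂ₜ|ω|²`), `TorusWeightedVorticityBalance` (`d/dt ∫ Φ(|ω|²)`),
`TorusVorticityMomentBalance` (Gibbon's `Jₘ = ∫|ω|^{2m}`, Gibbon 2010 App. A).

* `torusVorticityTensor v i j x = (∂ᵢv)ⱼ(x) − (∂ⱼv)ᵢ(x)`;
* `torusStretchingDensity v x = −∑ᵢⱼ Wᵢⱼ ∑ₖ (∂ᵢv)ₖ (∂ₖv)ⱼ`;
* `torusStretchingDensity_fin_three(_of_isDivFree)` — on `T³`: `σ = ωᵀSω − (div v)|ω|²`;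
* `IsClassicalNSSolutionOn.timeDerivWithin_torusVorticityTensor` — the transport identity.

## Mathlib / tree search

Reused: `Torus.timeDerivWithin_partialDeriv_comm`, `Torus.partialDeriv_laplacian_comm`,
`Torus.partialDeriv_comm`, `Torus.partialDeriv_convect_self`, `Torus.partialDeriv_apply_coord`,
`Torus.partialDeriv_add/_const_smul/_neg`, `Torus.gradient_eq_sum_partialDeriv`,
`Torus.IsSmoothSpaceTimeOn.partialDeriv/.apply/.hasDerivWithinAt_slice`; patterns of
`Torus.IsClassicalNSSolutionOn.hasDerivWithinAt_half_gradNormSq` (`TorusClassicalH1Balance`) and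
`DoeringGibbon1995.cubeTrace_sub_stretchCubic` (`ExtremeGrowthVorticityControlProofs`). Searched
`VorticityTensor|vortTensor|StretchingDensity` and `vorticity.?[Ee]quation` on the torus side: only
the `ℝ³` vorticity equation (`VorticityEquation.lean`, `IsClassicalNSSolutionOn.curl_timeDerivWithin_eq`)
and `BDSV.curl` commutation lemmas exist; no pointwise transport identity for `Wᵢⱼ`/`|ω|²` on `T^d`.

## References

* A. J. Majda, A. L. Bertozzi, *Vorticity and Incompressible Flow*, CUP 2002, §1.4 (1.18)–(1.21)
  (`𝒟`, `Ω`, `ω`, `Ωh = ½ω × h`), proof of Prop. 1.5: (1.29) `DV/Dt + V² = −P + νΔV`, (1.31)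
  `DΩ/Dt + Ω𝒟 + 𝒟Ω = νΔΩ`, (1.32) `Dω/Dt = 𝒟ω + νΔω` (held: book:majda2002-vorticity-incompressible-flow,
  chunks 15, 18–19). [MajdaBertozziCUP2002]
* J. D. Gibbon, *Regularity and singularity in solutions of the three-dimensional Navier–Stokes
  equations*, Proc. R. Soc. A 466 (2010) 2587–2604, doi:10.1098/rspa.2009.0642; §2 (definition
  `Jₘ = ∫|ω|^{2m} dV` on the periodic box `[0, L]³`) and Appendix A (proof of Prop. 1): the first
  display is `(1/2m) J̇ₘ = ∫ |ω|^{2(m−1)} ω·{νΔω + ω·∇u + curl f} dV`, step 1 bounds the Laplacian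
  term by `−(2(m−1)/m²)∫|∇(|ω|ᵐ)|²` (held: paper:arxiv-0905.0344, chunks 5–6, 9). [Gibbon2010]
* C. R. Doering, J. D. Gibbon, *Applied Analysis of the Navier–Stokes Equations*, CUP 1995, §6.5
  (6.5.18). [DoeringGibbon1995]
-/

noncomputable section

open Set MeasureTheory Finset
open scoped ContDiff InnerProductSpace RealInnerProductSpace

namespace Literature.Analysis.FluidPDE

open Literature.Analysis.FunctionSpaces

variable {d : Type*} [Fintype d] [DecidableEq d]

/-! ### The vorticity tensor and the stretching density -/

/-- The **vorticity tensor** `Wᵢⱼ(x) = (∂ᵢv)ⱼ(x) − (∂ⱼv)ᵢ(x)` of a velocity field on the torus —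
the antisymmetric part of the velocity gradient over `Torus.partialDeriv`: `W = ∇vᵗ − ∇v = −2Ω`
for the rotation matrix `Ω = ½(∇v − ∇vᵗ)`, `(∇v)ᵢⱼ = ∂ⱼvᵢ`, of Majda–Bertozzi 2002, §1.4 (1.19);
in `d = 3` the entries `W₁₂, W₂₀, W₀₁` are the components of `ω = curl v` ((1.20)–(1.21)), and
`torusVorticitySqAt v x = ½ ∑ᵢⱼ Wᵢⱼ(x)²` by definition. Junk value where `v` is not
differentiable (that of `Torus.partialDeriv`). [cite: MajdaBertozziCUP2002, §1.4 eq. (1.19)] -/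
def torusVorticityTensor (v : UnitAddTorus d → EuclideanSpace ℝ d) (i j : d) (x : UnitAddTorus d) : ℝ :=
  Torus.partialDeriv i v x j - Torus.partialDeriv j v x i

/-- `Wⱼᵢ = −Wᵢⱼ`: the vorticity tensor is antisymmetric (Majda–Bertozzi 2002, §1.4 (1.19):
`Ω = ½(∇v − ∇vᵗ)` "is called the rotation matrix", the antisymmetric part of `∇v`). [cite: MajdaBertozziCUP2002, §1.4 eq. (1.19)] -/
theorem torusVorticityTensor_swap (v : UnitAddTorus d → EuclideanSpace ℝ d) (i j : d)
    (x : UnitAddTorus d) : torusVorticityTensor v j i x = -torusVorticityTensor v i j x := by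
  unfold torusVorticityTensor; ring

/-- The **vortex-stretching density** `σ(x) := −∑ᵢⱼ Wᵢⱼ(x) ∑ₖ (∂ᵢv)ₖ(x) (∂ₖv)ⱼ(x) = tr(𝒟 W²)`
(`𝒟 = ½(∇v + ∇vᵗ)` the deformation matrix, `W = −2Ω` the vorticity tensor): the source term of
`½∂ₜ|ω|²` along the flow, i.e. the density `ω·𝒟ω` of the stretching term `𝒟ω` of the vorticity
equation `Dω/Dt = 𝒟ω + νΔω` (Majda–Bertozzi 2002, §1.4 (1.32)) paired with `ω`: on `T³`,
`σ = ωᵀ𝒟ω − (div v)|ω|²` (`torusStretchingDensity_fin_three`). Stated over `Torus.partialDeriv`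
in every dimension, without orientation. [cite: MajdaBertozziCUP2002, §1.4 eq. (1.32)] -/
def torusStretchingDensity (v : UnitAddTorus d → EuclideanSpace ℝ d) (x : UnitAddTorus d) : ℝ :=
  -∑ i, ∑ j, torusVorticityTensor v i j x *
    ∑ k, Torus.partialDeriv i v x k * Torus.partialDeriv k v x j

/-! ### `d = 3`: the stretching density is `ωᵀSω − (div v)|ω|²` -/

namespace VorticityTensor

/-- Polynomial identity behind `torusStretchingDensity_fin_three`: for a `3 × 3` array
`P` (`Pᵢₖ = ∂ᵢvₖ`), `W = P − Pᵀ`, `w = (W₁₂, W₂₀, W₀₁)`, `S = ½(P + Pᵀ)`: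
`−∑ᵢⱼ Wᵢⱼ (PP)ᵢⱼ = wᵀSw − (tr P)|w|²`. [folklore] -/
private theorem neg_sum_antisymm_mul_sq_eq (P : Fin 3 → Fin 3 → ℝ) (w : Fin 3 → ℝ)
    (hw : w = ![P 1 2 - P 2 1, P 2 0 - P 0 2, P 0 1 - P 1 0]) :
    -(∑ i, ∑ j, (P i j - P j i) * ∑ k, P i k * P k j) =
      (∑ a, ∑ b, w a * ((P a b + P b a) / 2) * w b) - (∑ a, P a a) * ∑ a, w a ^ 2 := by
  subst hw
  simp only [Fin.sum_univ_three, Matrix.cons_val_zero, Matrix.cons_val_one, Matrix.head_cons,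
    Matrix.cons_val_two, Matrix.tail_cons]
  ring

/-- `|w|² = ½ ∑ᵢⱼ (Pᵢⱼ − Pⱼᵢ)²` for `w = (W₁₂, W₂₀, W₀₁)`. [folklore] -/
private theorem sum_sq_eq_half_sum_antisymm_sq (P : Fin 3 → Fin 3 → ℝ) (w : Fin 3 → ℝ)
    (hw : w = ![P 1 2 - P 2 1, P 2 0 - P 0 2, P 0 1 - P 1 0]) :
    ∑ a, w a ^ 2 = 2⁻¹ * ∑ i, ∑ j, (P i j - P j i) ^ 2 := by
  subst hw
  simp only [Fin.sum_univ_three, Matrix.cons_val_zero, Matrix.cons_val_one, Matrix.head_cons,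
    Matrix.cons_val_two, Matrix.tail_cons]
  ring

end VorticityTensor

/-- **On `T³` the stretching density is `ωᵀSω − (div v)|ω|²`.** For any field `v` on
`UnitAddTorus (Fin 3)` and any point, with `ω = (W₁₂, W₂₀, W₀₁)` (the curl, Majda–Bertozzi (1.31))
and `Sₐᵦ = ½((∂ₐv)ᵦ + (∂ᵦv)ₐ)`:
`torusStretchingDensity v x = ∑ₐᵦ ωₐ Sₐᵦ ωᵦ − (∑ₐ (∂ₐv)ₐ) · torusVorticitySqAt v x`; for
divergence-free `v` the last term vanishes (`Torus.divergence_eq_sum_partialDeriv_apply`).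
A polynomial identity in the nine entries of `∇v(x)` (the "straightforward calculation" turning
(1.31) into (1.32) in Majda–Bertozzi 2002, §1.4, via `Ωh = ½ω × h`, (1.21)). [cite: MajdaBertozziCUP2002, §1.4 eqs. (1.21), (1.31)–(1.32)] -/
theorem torusStretchingDensity_fin_three (v : UnitAddTorus (Fin 3) → EuclideanSpace ℝ (Fin 3))
    (x : UnitAddTorus (Fin 3)) :
    torusStretchingDensity v x =
      (∑ a, ∑ b, torusVorticityTensor v (a + 1) (a + 2) x *
          ((Torus.partialDeriv a v x b + Torus.partialDeriv b v x a) / 2) *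
          torusVorticityTensor v (b + 1) (b + 2) x) -
        (∑ a, Torus.partialDeriv a v x a) * torusVorticitySqAt v x := by
  set P : Fin 3 → Fin 3 → ℝ := fun i k => Torus.partialDeriv i v x k with hP
  set w : Fin 3 → ℝ := ![P 1 2 - P 2 1, P 2 0 - P 0 2, P 0 1 - P 1 0] with hw
  have hwa : ∀ a : Fin 3, torusVorticityTensor v (a + 1) (a + 2) x = w a := by
    intro a
    fin_cases a <;> simp [hw, hP, torusVorticityTensor]
  have h1 := VorticityTensor.neg_sum_antisymm_mul_sq_eq P w hw
  have h2 := VorticityTensor.sum_sq_eq_half_sum_antisymm_sq P w hw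
  simp_rw [hwa]
  rw [torusStretchingDensity, torusVorticitySqAt, ← h2]
  simp only [torusVorticityTensor, hP] at h1 ⊢
  rw [h1]


/-! ### Calculus complements -/

namespace VorticityTensor

omit [DecidableEq d] in
/-- Coordinates of the vector Laplacian: `(Δv)ⱼ = Δ(vⱼ)` for smooth `v`. [folklore] -/
private theorem laplacian_apply_coord {v : UnitAddTorus d → EuclideanSpace ℝ d}
    (hv : Torus.IsSmooth v) (x : UnitAddTorus d) (j : d) :
    Torus.laplacian v x j = Torus.laplacian (fun y => v y j) x := by
  have h2 : ContDiffAt ℝ 2 (Torus.liftAt v x) 0 :=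
    ((hv.liftAt x).of_le (WithTop.coe_le_coe.mpr le_top)).contDiffAt
  have key := h2.laplacian_CLM_comp_left
    (l := (EuclideanSpace.proj j : EuclideanSpace ℝ d →L[ℝ] ℝ))
  have hl : Torus.liftAt (fun y => v y j) x =
      (EuclideanSpace.proj j : EuclideanSpace ℝ d →L[ℝ] ℝ) ∘ Torus.liftAt v x := rfl
  simp only [Torus.laplacian, hl, key, Function.comp_apply]
  rfl

/-- Coordinates of the torus gradient: `(∇θ)ⱼ = ∂ⱼθ` for `C¹` `θ`. [folklore] -/
private theorem gradient_apply_eq_partialDeriv {θ : UnitAddTorus d → ℝ} (hθ : Torus.IsContDiff 1 θ)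
    (x : UnitAddTorus d) (j : d) : Torus.gradient θ x j = Torus.partialDeriv j θ x := by
  rw [Torus.gradient_eq_sum_partialDeriv hθ]
  simp [Finset.sum_apply, Pi.single_apply]

omit [DecidableEq d] in
/-- Coordinates of one-sided time derivatives: `(∂ₜφ)ⱼ = ∂ₜ(φⱼ)` for jointly smooth `φ`. [folklore] -/
private theorem timeDerivWithin_apply_coord {S : Set ℝ} {φ : ℝ → UnitAddTorus d → EuclideanSpace ℝ d}
    (hφ : Torus.IsSmoothSpaceTimeOn S φ) (hS : UniqueDiffOn ℝ S) {t : ℝ} (ht : t ∈ S)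
    (x : UnitAddTorus d) (j : d) :
    Torus.timeDerivWithin S (fun s y => φ s y j) t x = Torus.timeDerivWithin S φ t x j := by
  have h := hφ.hasDerivWithinAt_slice ht x
  have h2 : HasDerivWithinAt (fun τ => φ τ x j) (Torus.timeDerivWithin S φ t x j) S t :=
    (EuclideanSpace.proj j : EuclideanSpace ℝ d →L[ℝ] ℝ).hasFDerivAt.comp_hasDerivWithinAt t h
  exact h2.derivWithin (hS t ht)

end VorticityTensor

/-- `∂ₖWᵢⱼ = (∂ₖ∂ᵢv)ⱼ − (∂ₖ∂ⱼv)ᵢ` for smooth `v`. [folklore] -/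
private theorem partialDeriv_torusVorticityTensor {v : UnitAddTorus d → EuclideanSpace ℝ d}
    (hv : Torus.IsSmooth v) (i j k : d) (x : UnitAddTorus d) :
    Torus.partialDeriv k (torusVorticityTensor v i j) x =
      Torus.partialDeriv k (Torus.partialDeriv i v) x j -
        Torus.partialDeriv k (Torus.partialDeriv j v) x i := by
  have hi : Torus.IsContDiff 1 (fun y => Torus.partialDeriv i v y j) :=
    ((hv.partialDeriv i).apply j).isContDiff (by simp)
  have hj : Torus.IsContDiff 1 (fun y => -Torus.partialDeriv j v y i) :=
    ((hv.partialDeriv j).apply i).neg.isContDiff (by simp)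
  have hfun : torusVorticityTensor v i j =
      (fun y => Torus.partialDeriv i v y j) + fun y => -Torus.partialDeriv j v y i := by
    funext y; simp [torusVorticityTensor, sub_eq_add_neg]
  rw [hfun, Torus.partialDeriv_add hi hj k, Pi.add_apply, Torus.partialDeriv_neg,
    Torus.partialDeriv_apply_coord ((hv.partialDeriv i).isContDiff (by simp)),
    Torus.partialDeriv_apply_coord ((hv.partialDeriv j).isContDiff (by simp))]
  ring

/-- `W ᵢⱼ` of a smooth field is smooth. [folklore] -/
private theorem isSmooth_torusVorticityTensor {v : UnitAddTorus d → EuclideanSpace ℝ d}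
    (hv : Torus.IsSmooth v) (i j : d) : Torus.IsSmooth (torusVorticityTensor v i j) :=
  ((hv.partialDeriv i).apply j).sub ((hv.partialDeriv j).apply i)

/-- `ΔWᵢⱼ = (Δ∂ᵢv)ⱼ − (Δ∂ⱼv)ᵢ = (∂ᵢΔv)ⱼ − (∂ⱼΔv)ᵢ` for smooth `v`. [folklore] -/
private theorem laplacian_torusVorticityTensor {v : UnitAddTorus d → EuclideanSpace ℝ d}
    (hv : Torus.IsSmooth v) (i j : d) (x : UnitAddTorus d) :
    Torus.laplacian (torusVorticityTensor v i j) x =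
      Torus.partialDeriv i (Torus.laplacian v) x j - Torus.partialDeriv j (Torus.laplacian v) x i := by
  have hi : Torus.IsSmooth (fun y => Torus.partialDeriv i v y j) := (hv.partialDeriv i).apply j
  have hj : Torus.IsSmooth (fun y => Torus.partialDeriv j v y i) := (hv.partialDeriv j).apply i
  have hfun : torusVorticityTensor v i j =
      (fun y => Torus.partialDeriv i v y j) + (-1 : ℝ) • fun y => Torus.partialDeriv j v y i := by
    funext y; simp [torusVorticityTensor, sub_eq_add_neg]
  rw [hfun, Torus.laplacian_add_apply hi (hj.smul (-1)), Torus.laplacian_const_smul_apply hj,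
    Torus.partialDeriv_laplacian_comm hv i, Torus.partialDeriv_laplacian_comm hv j,
    VorticityTensor.laplacian_apply_coord (hv.partialDeriv i),
    VorticityTensor.laplacian_apply_coord (hv.partialDeriv j), smul_eq_mul]
  ring

/-! ### The transport identity for the vorticity tensor -/

/-- **The vorticity-tensor transport identity** (Majda–Bertozzi 2002, §1.4 (1.31):
`DΩ/Dt + Ω𝒟 + 𝒟Ω = νΔΩ`, the antisymmetric part of `DV/Dt + V² = −P + νΔV`, (1.29), obtained by
"computing the `∂_{x_k}` derivative of the Navier–Stokes equation"; here with a forcing term and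
`W = −2Ω`). Along a classical solution of `∂ₜu + (u·∇)u = νΔu − ∇p + f`, `div u = 0` on
`T^d × [a, b]` (`a < b`), for every `t ∈ [a, b]`, every point `x` and all indices `i, j`:
`∂ₜWᵢⱼ = ν ΔWᵢⱼ + (∂ᵢfⱼ − ∂ⱼfᵢ) − (∑ₖ ∂ᵢuₖ ∂ₖuⱼ − ∑ₖ ∂ⱼuₖ ∂ₖuᵢ) − ∑ₖ uₖ ∂ₖWᵢⱼ`
(one-sided time derivative within `[a, b]`; `(V²)ᵢⱼ − (V²)ⱼᵢ = (Ω𝒟 + 𝒟Ω)`-part). Proof as printed: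
`∂ₜ∂ᵢ = ∂ᵢ∂ₜ`, differentiate the momentum equation, `∂ᵢ((u·∇)u)ⱼ = ∑ₖ uₖ ∂ₖ∂ᵢuⱼ + ∑ₖ ∂ᵢuₖ ∂ₖuⱼ`
(`Torus.partialDeriv_convect_self`), and the pressure Hessian `∂ᵢ∂ⱼp` is symmetric, so it drops
from the antisymmetric part. [cite: MajdaBertozziCUP2002, §1.4 eq. (1.31)] -/
theorem _root_.Literature.Analysis.FunctionSpaces.Torus.IsClassicalNSSolutionOn.timeDerivWithin_torusVorticityTensor
    {a b ν : ℝ} {f u : ℝ → UnitAddTorus d → EuclideanSpace ℝ d} {p : ℝ → UnitAddTorus d → ℝ}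
    (h : Torus.IsClassicalNSSolutionOn (Icc a b) ν f u p) (hab : a < b) {t : ℝ}
    (ht : t ∈ Icc a b) (i j : d) (x : UnitAddTorus d) :
    Torus.timeDerivWithin (Icc a b) (fun s y => torusVorticityTensor (u s) i j y) t x =
      ν * Torus.laplacian (torusVorticityTensor (u t) i j) x +
        (Torus.partialDeriv i (f t) x j - Torus.partialDeriv j (f t) x i) -
        ((∑ k, Torus.partialDeriv i (u t) x k * Torus.partialDeriv k (u t) x j) -
          ∑ k, Torus.partialDeriv j (u t) x k * Torus.partialDeriv k (u t) x i) -
        ∑ k, u t x k * Torus.partialDeriv k (torusVorticityTensor (u t) i j) x := by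
  set S : Set ℝ := Icc a b with hSdef
  have hU : UniqueDiffOn ℝ S := uniqueDiffOn_Icc hab
  have hu : Torus.IsSmoothSpaceTimeOn S u := h.smooth_velocity
  have hut : Torus.IsSmooth (u t) := hu.isSmooth_slice ht
  have hu1 : Torus.IsContDiff 1 (u t) := hut.isContDiff (by simp)
  have hpt : Torus.IsSmooth (p t) := h.smooth_pressure.isSmooth_slice ht
  set A : UnitAddTorus d → EuclideanSpace ℝ d := Torus.timeDerivWithin S u t with hAdef
  have hA : Torus.IsSmooth A := hu.isSmooth_timeDerivWithin hU ht
  have hΔ : Torus.IsSmooth (Torus.laplacian (u t)) := hut.laplacian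
  have hC : Torus.IsSmooth (Torus.convect (u t) (u t)) := hut.convect hut
  have hG : Torus.IsSmooth (Torus.gradient (p t)) := hpt.gradient
  have hDi : ∀ m, Torus.IsSmoothSpaceTimeOn S (fun s => Torus.partialDeriv m (u s)) :=
    fun m => hu.partialDeriv hU m
  -- the forcing slice is smooth (momentum equation)
  have hf : Torus.IsSmooth (f t) := by
    have hfun : f t = fun y => A y + Torus.convect (u t) (u t) y - ν • Torus.laplacian (u t) y +
        Torus.gradient (p t) y := by
      funext y
      have := h.momentum t ht y
      rw [hAdef, this]
      abel
    rw [hfun]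
    exact ((hA.add hC).sub (hΔ.smul ν)).add hG
  -- Step 1: `∂ₜWᵢⱼ = (∂ᵢ∂ₜu)ⱼ − (∂ⱼ∂ₜu)ᵢ`
  have hslice : ∀ m n, HasDerivWithinAt (fun s => Torus.partialDeriv m (u s) x n)
      (Torus.partialDeriv m A x n) S t := by
    intro m n
    have h1 := ((hDi m).apply n).hasDerivWithinAt_slice ht x
    rw [VorticityTensor.timeDerivWithin_apply_coord (hDi m) hU ht x n,
      Torus.timeDerivWithin_partialDeriv_comm hab hu ht m x] at h1
    exact h1
  have hW : HasDerivWithinAt (fun s => torusVorticityTensor (u s) i j x)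
      (Torus.partialDeriv i A x j - Torus.partialDeriv j A x i) S t :=
    (hslice i j).sub (hslice j i)
  rw [Torus.timeDerivWithin, hW.derivWithin (hU t ht)]
  -- Step 2: `∂ᵢ A` from the momentum equation
  have hAfun : A = ν • Torus.laplacian (u t) + ((fun y => -Torus.gradient (p t) y) +
      (f t + fun y => -Torus.convect (u t) (u t) y)) := by
    funext y
    have := h.momentum t ht y
    simp only [Pi.add_apply, Pi.smul_apply]
    rw [hAdef, eq_sub_of_add_eq this]
    abel
  have c1 : Torus.IsContDiff 1 (ν • Torus.laplacian (u t)) := (hΔ.smul ν).isContDiff (by simp)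
  have c2 : Torus.IsContDiff 1 (fun y => -Torus.gradient (p t) y) := hG.neg.isContDiff (by simp)
  have c3 : Torus.IsContDiff 1 (f t) := hf.isContDiff (by simp)
  have c4 : Torus.IsContDiff 1 (fun y => -Torus.convect (u t) (u t) y) :=
    hC.neg.isContDiff (by simp)
  have hDA : ∀ m, Torus.partialDeriv m A x = ν • Torus.partialDeriv m (Torus.laplacian (u t)) x -
      Torus.partialDeriv m (Torus.gradient (p t)) x + Torus.partialDeriv m (f t) x -
      Torus.partialDeriv m (Torus.convect (u t) (u t)) x := by
    intro m
    rw [hAfun, Torus.partialDeriv_add c1 (c2.add (c3.add c4)) m, Torus.partialDeriv_add c2 (c3.add c4) m,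
      Torus.partialDeriv_add c3 c4 m]
    simp only [Pi.add_apply]
    rw [Torus.partialDeriv_const_smul (hΔ.isContDiff (by simp)) ν m, Pi.smul_apply,
      Torus.partialDeriv_neg, Torus.partialDeriv_neg]
    abel
  -- coordinates of the four pieces
  have hgrad : ∀ m n, Torus.partialDeriv m (Torus.gradient (p t)) x n =
      Torus.partialDeriv m (Torus.partialDeriv n (p t)) x := by
    intro m n
    rw [← Torus.partialDeriv_apply_coord (hG.isContDiff (by simp)) m x n]
    congr 1
    funext y
    exact VorticityTensor.gradient_apply_eq_partialDeriv (hpt.isContDiff (by simp)) y n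
  have hpress : Torus.partialDeriv i (Torus.gradient (p t)) x j =
      Torus.partialDeriv j (Torus.gradient (p t)) x i := by
    rw [hgrad, hgrad, Torus.partialDeriv_comm hpt]
  have hconv : ∀ m n, Torus.partialDeriv m (Torus.convect (u t) (u t)) x n =
      (∑ k, u t x k * Torus.partialDeriv k (Torus.partialDeriv m (u t)) x n) +
        ∑ k, Torus.partialDeriv m (u t) x k * Torus.partialDeriv k (u t) x n := by
    intro m n
    rw [Torus.partialDeriv_convect_self hut m x]
    simp only [WithLp.ofLp_sum, WithLp.ofLp_add, WithLp.ofLp_smul, Finset.sum_apply, Pi.add_apply,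
      Pi.smul_apply, smul_eq_mul, Finset.sum_add_distrib]
    congr 1
    refine Finset.sum_congr rfl fun k _ => ?_
    rw [Torus.partialDeriv_comm hut m k x]
  have hvisc : ν * Torus.laplacian (torusVorticityTensor (u t) i j) x =
      ν * Torus.partialDeriv i (Torus.laplacian (u t)) x j -
        ν * Torus.partialDeriv j (Torus.laplacian (u t)) x i := by
    rw [laplacian_torusVorticityTensor hut]; ring
  have htrans : ∑ k, u t x k * Torus.partialDeriv k (torusVorticityTensor (u t) i j) x =
      (∑ k, u t x k * Torus.partialDeriv k (Torus.partialDeriv i (u t)) x j) -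
        ∑ k, u t x k * Torus.partialDeriv k (Torus.partialDeriv j (u t)) x i := by
    rw [← Finset.sum_sub_distrib]
    refine Finset.sum_congr rfl fun k _ => ?_
    rw [partialDeriv_torusVorticityTensor hut]; ring
  rw [hvisc, htrans]
  simp only [hDA, WithLp.ofLp_sub, WithLp.ofLp_add, WithLp.ofLp_smul, Pi.sub_apply, Pi.add_apply,
    Pi.smul_apply, smul_eq_mul, hconv, hpress]
  ring

/-- **On `T³`, for divergence-free fields, `σ = ωᵀ𝒟ω`** (`ω = (W₁₂, W₂₀, W₀₁)`,
`𝒟ₐᵦ = ½((∂ₐv)ᵦ + (∂ᵦv)ₐ)`): the density of the stretching term `𝒟ω` of the vorticity equation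
(1.32) of Majda–Bertozzi 2002 paired with `ω` (`tr 𝒟 = div v = 0`, §1.4 after (1.19)). [cite: MajdaBertozziCUP2002, §1.4 eq. (1.32)] -/
theorem torusStretchingDensity_fin_three_of_isDivFree
    {v : UnitAddTorus (Fin 3) → EuclideanSpace ℝ (Fin 3)} (hv : Torus.IsContDiff 1 v)
    (hdiv : Torus.IsDivFree v) (x : UnitAddTorus (Fin 3)) :
    torusStretchingDensity v x =
      ∑ a, ∑ b, torusVorticityTensor v (a + 1) (a + 2) x *
        ((Torus.partialDeriv a v x b + Torus.partialDeriv b v x a) / 2) *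
        torusVorticityTensor v (b + 1) (b + 2) x := by
  rw [torusStretchingDensity_fin_three, ← Torus.divergence_eq_sum_partialDeriv_apply hv x, hdiv x,
    zero_mul, sub_zero]

/-! ### `card d = 3` with an arbitrary labelling `e : d ≃ Fin 3` (the `d`-indexed strain of K1) -/

namespace VorticityTensor

/-- Shape variant of `neg_sum_antisymm_mul_sq_eq`: strain written `½(Pᵦₐ + Pₐᵦ)` and `|w|²`
replaced by `½∑ᵢⱼ(Pᵢⱼ − Pⱼᵢ)²`. [folklore] -/
private theorem neg_sum_antisymm_mul_sq_eq' (P : Fin 3 → Fin 3 → ℝ) (w : Fin 3 → ℝ)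
    (hw : w = ![P 1 2 - P 2 1, P 2 0 - P 0 2, P 0 1 - P 1 0]) :
    -(∑ i, ∑ j, (P i j - P j i) * ∑ k, P i k * P k j) =
      (∑ a, ∑ b, w a * ((P b a + P a b) / 2) * w b) -
        (∑ a, P a a) * (2⁻¹ * ∑ i, ∑ j, (P i j - P j i) ^ 2) := by
  subst hw
  simp only [Fin.sum_univ_three, Matrix.cons_val_zero, Matrix.cons_val_one, Matrix.head_cons,
    Matrix.cons_val_two, Matrix.tail_cons]
  ring

end VorticityTensor

/-- **`|ω|²` as a sum of three squares, any labelling.** For an index type with three elements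
labelled by `e : d ≃ Fin 3`, the axial vector `ωᵢ := W_{e⁻¹(e i + 1), e⁻¹(e i + 2)}` — the curl of
`v` read in the frame `e` (Majda–Bertozzi 2002, §1.4 (1.21): `Ωh = ½ω × h`; for the opposite
orientation it is `−curl v`, immaterial in every quadratic expression) — has
`∑ᵢ ωᵢ² = torusVorticitySqAt v x` (`= ½∑ᵢⱼWᵢⱼ²`). [cite: MajdaBertozziCUP2002, §1.4 eqs. (1.21), (1.31)] -/
theorem torusVorticitySqAt_eq_sum_sq_of_equiv (e : d ≃ Fin 3)
    (v : UnitAddTorus d → EuclideanSpace ℝ d) (x : UnitAddTorus d) :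
    torusVorticitySqAt v x =
      ∑ i, torusVorticityTensor v (e.symm (e i + 1)) (e.symm (e i + 2)) x ^ 2 := by
  set P : Fin 3 → Fin 3 → ℝ := fun a b => Torus.partialDeriv (e.symm a) v x (e.symm b) with hP
  set w : Fin 3 → ℝ := ![P 1 2 - P 2 1, P 2 0 - P 0 2, P 0 1 - P 1 0] with hw
  have hre : ∀ G : d → ℝ, ∑ i, G i = ∑ a : Fin 3, G (e.symm a) := fun G =>
    Fintype.sum_equiv e _ _ fun i => by simp
  have hwa : ∀ a : Fin 3,
      torusVorticityTensor v (e.symm (e (e.symm a) + 1)) (e.symm (e (e.symm a) + 2)) x = w a := by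
    intro a
    rw [e.apply_symm_apply]
    fin_cases a <;> simp [hw, hP, torusVorticityTensor]
  rw [hre, Finset.sum_congr rfl fun a _ => by rw [hwa a],
    VorticityTensor.sum_sq_eq_half_sum_antisymm_sq P w hw, torusVorticitySqAt, hre]
  simp_rw [hre]
  simp only [hP]

/-- **`card d = 3`, any labelling: `σ = ωᵀSω − (div v)|ω|²` with the `d`-indexed strain.** For
`e : d ≃ Fin 3` and `ωᵢ := W_{e⁻¹(e i + 1), e⁻¹(e i + 2)}` (the curl read in the frame `e`,
`torusVorticitySqAt_eq_sum_sq_of_equiv`), and the strain matrix `Sᵢⱼ = ½((∂ⱼv)ᵢ + (∂ᵢv)ⱼ)`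
indexed by `d` itself:
`torusStretchingDensity v x = ∑ᵢⱼ ωᵢ Sᵢⱼ ωⱼ − (∑ᵢ (∂ᵢv)ᵢ) · torusVorticitySqAt v x` — the
`Fin 3` identity `torusStretchingDensity_fin_three` transported along `e` (a relabelling of a
polynomial identity; Majda–Bertozzi 2002, §1.4, (1.31) ⇒ (1.32) via (1.21)). [cite: MajdaBertozziCUP2002, §1.4 eqs. (1.21), (1.31)–(1.32)] -/
theorem torusStretchingDensity_eq_sum_strain_of_equiv (e : d ≃ Fin 3)
    (v : UnitAddTorus d → EuclideanSpace ℝ d) (x : UnitAddTorus d) :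
    torusStretchingDensity v x =
      (∑ i, ∑ j, torusVorticityTensor v (e.symm (e i + 1)) (e.symm (e i + 2)) x *
          ((Torus.partialDeriv j v x i + Torus.partialDeriv i v x j) / 2) *
          torusVorticityTensor v (e.symm (e j + 1)) (e.symm (e j + 2)) x) -
        (∑ i, Torus.partialDeriv i v x i) * torusVorticitySqAt v x := by
  set P : Fin 3 → Fin 3 → ℝ := fun a b => Torus.partialDeriv (e.symm a) v x (e.symm b) with hP
  set w : Fin 3 → ℝ := ![P 1 2 - P 2 1, P 2 0 - P 0 2, P 0 1 - P 1 0] with hw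
  have hre : ∀ G : d → ℝ, ∑ i, G i = ∑ a : Fin 3, G (e.symm a) := fun G =>
    Fintype.sum_equiv e _ _ fun i => by simp
  have hwa : ∀ a : Fin 3,
      torusVorticityTensor v (e.symm (e (e.symm a) + 1)) (e.symm (e (e.symm a) + 2)) x = w a := by
    intro a
    rw [e.apply_symm_apply]
    fin_cases a <;> simp [hw, hP, torusVorticityTensor]
  have h1 := VorticityTensor.neg_sum_antisymm_mul_sq_eq' P w hw
  rw [torusStretchingDensity, torusVorticitySqAt]
  simp only [torusVorticityTensor] at hwa ⊢
  simp_rw [hre]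
  simp only [hwa] at *
  simpa [hP] using h1

/-- **`card d = 3`, any labelling, divergence-free: `σ = ωᵀSω`** with the `d`-indexed strain
`Sᵢⱼ = ½((∂ⱼv)ᵢ + (∂ᵢv)ⱼ)` and `ωᵢ := W_{e⁻¹(e i + 1), e⁻¹(e i + 2)}` — the density of the
stretching term `𝒟ω·ω` of Majda–Bertozzi 2002, (1.32) (`tr 𝒟 = div v = 0`). This is the
pointwise integrand of Gibbon's `J̇ₘ` source `∫|ω|^{2(m−1)} ω·(ω·∇u) = ∫|ω|^{2(m−1)} ω·Sω`
(Gibbon 2010, App. A) in the frame-free vocabulary of `TorusVorticityMomentBalance`. [cite: MajdaBertozziCUP2002, §1.4 eq. (1.32)] -/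
theorem torusStretchingDensity_eq_sum_strain_of_equiv_of_isDivFree (e : d ≃ Fin 3)
    {v : UnitAddTorus d → EuclideanSpace ℝ d} (hv : Torus.IsContDiff 1 v)
    (hdiv : Torus.IsDivFree v) (x : UnitAddTorus d) :
    torusStretchingDensity v x =
      ∑ i, ∑ j, torusVorticityTensor v (e.symm (e i + 1)) (e.symm (e i + 2)) x *
        ((Torus.partialDeriv j v x i + Torus.partialDeriv i v x j) / 2) *
        torusVorticityTensor v (e.symm (e j + 1)) (e.symm (e j + 2)) x := by
  rw [torusStretchingDensity_eq_sum_strain_of_equiv e,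
    ← Torus.divergence_eq_sum_partialDeriv_apply hv x, hdiv x, zero_mul, sub_zero]

end Literature.Analysis.FluidPDE
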